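import Summits.HodgeConjecture.CorCM.GaloisDodecicStabiliserLemma
import Summits.HodgeConjecture.CorCM.GaloisOcticSimpleCMFourfolds
import Summits.HodgeConjecture.CorCM.CMSixfoldRank.DegreeTwelveCMTypes
import Literature.AlgebraicGeometry.Pohlmann1968.NondegenerateCMTypeHodgeConjecture
import Literature.AlgebraicGeometry.ComplexMultiplication.SimpleIffPrimitiveCMType
import Mathlib.FieldTheory.Galois.Basic
import HarnessLib

/-!
# Simple CM abelian sixfolds whose CM field is GALOIS over `ℚ` with non-abelian or cyclic Galois group are
# nondegenerate — and the Hodge conjecture for all their powers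

COR-CM (cell `pub-hodgecm2`), binder seat b04 (gen 14), count-neutral claim GALOIS-DODECIC, part II; sequel of
the tree's `CorCM/CMSixfoldRank/DegreeTwelveCMTypes` (lit-deligne-3: a PRIMITIVE CM type `Φ` of a CM field `K` of
degree `12` is degenerate iff `K` contains an (imaginary) quadratic subfield `k`, with a complex place, over which
`Φ` is balanced `(3,3)` — `CMSixfoldRank.not_isNondegenerate_iff_exists_weilFibre`, imported BY NAME), of the octic
file `CorCM/GaloisOcticSimpleCMFourfolds` (gen 13: every primitive type of a GALOIS octic CM field is nondegenerate),
and of parts Ia/Ib `CorCM/GaloisDodecicOrderSixSubgroup`, `CorCM/GaloisDodecicStabiliserLemma` (pure group theory).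
KERNEL ONLY: theorems, no definition, no named fact, no `sorry`.  `HC_CM` is not used and not claimed: this is the
Hodge conjecture for a NAMED SUB-CLASS of CM abelian varieties (simple sixfolds with Galois CM field of non-abelian or
cyclic Galois type, and their powers), UNCONDITIONALLY.

## The print

* B. Dodson, *The structure of Galois groups of CM-fields* [Dodson1984], §4 (p. 18): "The partition
  `64 = 4 + 12 + 12 + 12 + 24` from `n = 6`, `G = D₁₂`" (the `64` CM types of a dihedral Galois CM field of degree
  `12`: `4` from the two imaginary quadratic subfields, `36` from the six dihedral sextic CM subfields, `24` primitive);
  §5.0 (p. 19) / §5.3 (pp. 24–27): "Preliminary results for `n = 6`" — degenerate examples for `n = 6` only for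
  `G₀ ∈ {ℤ₆, A₄, Im(2,3)⁺}` (§5.3 Corollary), none for `G₀ = S₃`; no nondegeneracy theorem for the Galois groups of
  order `12` is stated.
* B. J. J. Moonen, Yu. G. Zarhin [MoonenZarhin1999LowDim], Thm. 0.1 (1.4), §5; B. B. Gordon [Gordon1999HodgeAVSurvey]
  5.13, Thm. 6.4 (Hazama), 9.4; [Dodson1987] Thm. 1.0 (tree `CMSixfoldRank`: degenerate ⟺ Weil fibre `(3,3)`).

## What is proved (NEW: the Galois-group side; every arrow below is a kernel theorem, axioms
## `propext · Classical.choice · Quot.sound`)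

Let `K` be a GALOIS CM field with `[K:ℚ] = 12`, `G = Gal(K/ℚ)`, `c ∈ G` complex conjugation (central), `Φ` a CM
type of `K`.
§1 `not_isPrimitive_of_fibres_balanced_of_isGalois_twelve`: if `Φ` is balanced over an imaginary quadratic subfield
   `k` whose group `Gal(K/k)` (order `6`, index `2`, `c ∉ Gal(K/k)`) is NON-COMMUTATIVE, then `Φ` is NOT primitive
   (part Ib gives `u ≠ 1` with `uT = T`, `T = {g | σ_g ∈ Φ}`: the translates of `Φ` do not separate `σ_1`, `σ_u`).
§2 `exists_quadratic_comm_of_not_isNondegenerate`: a PRIMITIVE DEGENERATE `Φ` forces an imaginary quadratic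
   `k ⊆ K` with `Gal(K/k)` COMMUTATIVE; hence (`comm_of_isPrimitive_of_not_isNondegenerate`) `G` is commutative and
   (`not_isCyclic_of_isPrimitive_of_not_isNondegenerate`) NOT cyclic — i.e. a degenerate simple CM sixfold with Galois
   CM field has Galois group `ℤ/2 × ℤ/6`.
§3 Consequently **every primitive CM type of a Galois CM field of degree `12` whose Galois group is non-abelian
   (dihedral `D₆ ≅ ℤ/2 × S₃`, dicyclic `Dic₃`) or cyclic (`ℤ/12`) is NONDEGENERATE** (rank `7`):
   `isNondegenerate_of_isPrimitive_of_isGalois_twelve_of_not_comm`, `…_of_isCyclic`; without any Galois hypothesis,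
   `isNondegenerate_of_isPrimitive_of_forall_quadratic_isReal` (a CM field of degree `12` with NO imaginary quadratic
   subfield); and the umbrella `isNondegenerate_of_isPrimitive_of_finrank_le_twelve` for CM fields of degree `≤ 12`.
§4 Realisations `(A, ι, θ)` with `A` SIMPLE (⟺ `Φ` primitive, Shimura §8.2 Prop. 26): `Bᵐ(Aⁿ) ⊗ ℂ = Dᵐ(Aⁿ) ⊗ ℂ` on
   every power, no exceptional Hodge class on any power, and **the Hodge conjecture for `A` and every power `Aⁿ`,
   UNCONDITIONALLY**, for every simple abelian SIXFOLD with complex multiplication by a Galois CM field of non-abelian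
   or cyclic Galois type (`hodgeConjectureFor_pow_of_isSimple_of_isGalois_twelve`), and
   by a CM field of degree `12` without imaginary quadratic subfield (`…_of_forall_quadratic_isReal`).
The residual Galois type `ℤ/2 × ℤ/6` does carry degenerate primitive types (group-level census: `24` of its `48`
primitive types, all of corank one; e.g. `ℚ(ζ₂₁)`, tree `Pohlmann1968/DegenerateCMTypeCyclotomic21`).
-/

noncomputable section

open CategoryTheory CategoryTheory.Limits NumberField

namespace Summit.HodgeConjecture.CorCM.GaloisDodecic

open Literature.NumberTheory.ComplexMultiplication
open Literature.AlgebraicGeometry.Motives (AbelianVariety CMType)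
open Literature.AlgebraicGeometry.Pohlmann1968
open Literature.AlgebraicGeometry.HodgeTheory
open Literature.AlgebraicGeometry.ComplexMultiplication (IsCMTypeRealisation isSimple_iff_isPrimitive)
open Literature.AlgebraicGeometry.VanGeemen1994 (hodgeClassSpan)
open Literature.Barriers.HodgeConjecture (divisorClassesSpan)
open Summit.HodgeConjecture.CorCM.GaloisOctic

open scoped Classical

/-! ## §1 Balanced over an imaginary quadratic subfield with non-abelian `Gal(K/k)` ⟹ not primitive -/

section Main

variable {K : Type} [Field K] [NumberField K] [IsCMField K] {Φ : CMType K}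

/-- **A CM type of a GALOIS CM field of degree `12` with multiplicities `(3,3)` over a quadratic subfield `k` with
a complex place, such that `Gal(K/k)` is NON-COMMUTATIVE, is NOT primitive.**  With `G = Gal(K/ℚ)`,
`H = Gal(K/k)` (order `6`, index `2`), `c` complex conjugation (central, `c ∉ H`) and `T = {g | σ_g ∈ Φ}`: the fibre
of `φ₀|_k` is `{σ_h | h ∈ H}`, so "balanced" says `|T ∩ H| = |H ∖ T|`, and the stabiliser lemma
`GaloisDodecic.exists_ne_one_forall_mem_iff` gives `u ≠ 1` with `uT = T`; then every translate `τΦ` (`τ ∈ Aut(ℂ)`,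
acting by `σ_g ↦ σ_{gδ⁻¹}`) contains `σ_1` iff it contains `σ_u`, so the translates do not separate the embeddings
(`isPrimitive_iff_forall_eq`).  NEW (cf. [cite: Dodson1984, §4 (p. 18)]: the `D₁₂` partition
`64 = 4 + 12 + 12 + 12 + 24`). -/
theorem not_isPrimitive_of_fibres_balanced_of_isGalois_twelve [IsGalois ℚ K] (hK : Module.finrank ℚ K = 12)
    (φ₀ : K →+* ℂ) (k : IntermediateField ℚ K) (hk2 : Module.finrank ℚ k = 2) (τ₀ : k →+* ℂ)
    (hτ₀ : ComplexEmbedding.conjugate τ₀ ≠ τ₀)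
    (hnc : ∃ a ∈ k.fixingSubgroup, ∃ b ∈ k.fixingSubgroup, a * b ≠ b * a)
    (hbal : ∀ τ : k →+* ℂ, {φ : K →+* ℂ | φ.comp (algebraMap k K) = τ ∧ φ ∈ Φ.1}.ncard =
      {φ : K →+* ℂ | φ.comp (algebraMap k K) = τ ∧ φ ∉ Φ.1}.ncard) :
    ¬ IsPrimitive (ℂ ≃+* ℂ) Φ.1 φ₀ := by
  haveI := isPretransitive_ringEquiv_complex (K := K)
  set G := K ≃ₐ[ℚ] K
  set c : G := (IsCMField.complexConj K).restrictScalars ℚ with hc_def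
  set H : Subgroup G := k.fixingSubgroup with hH_def
  set T : Set G := {g | embOf φ₀ g ∈ Φ.1} with hT_def
  -- `|G| = 12`, `|H| = [K:k] = 6`, index `2`
  have hG : Nat.card G = 12 := by rw [IsGalois.card_aut_eq_finrank, hK]
  have hKk : Module.finrank k K = 6 := by
    have h := Module.finrank_mul_finrank ℚ k K
    rw [hK, hk2] at h
    omega
  have hH : Nat.card H = 6 := by rw [hH_def, IsGalois.card_fixingSubgroup_eq_finrank k, hKk]
  have hidx : H.index = 2 := by
    have h := H.index_mul_card
    rw [hH, hG] at h
    omega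
  have hcH : c ∉ H := complexConj_not_mem_fixingSubgroup k τ₀ hτ₀
  have hT : ∀ g : G, c * g ∈ T ↔ g ∉ T := fun g => embOf_complexConj_mul_mem_iff Φ φ₀ g
  -- the fibre over `φ₀|_k` inside / outside `Φ` is the image of `T ∩ H` / `H ∖ T` under the injection `g ↦ σ_g`
  have hinj : Function.Injective (embOf φ₀) := (embOf_bijective φ₀).1
  have hfib : ∀ P : (K →+* ℂ) → Prop,
      {φ : K →+* ℂ | φ.comp (algebraMap k K) = φ₀.comp (algebraMap k K) ∧ P φ} =
        embOf φ₀ '' {g : G | g ∈ H ∧ P (embOf φ₀ g)} := by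
    intro P
    ext φ
    constructor
    · rintro ⟨hφk, hφ⟩
      obtain ⟨g, rfl⟩ := (embOf_bijective φ₀).2 φ
      exact ⟨g, ⟨(embOf_comp_algebraMap_eq_iff φ₀ k g).1 hφk, hφ⟩, rfl⟩
    · rintro ⟨g, ⟨hg, hP⟩, rfl⟩
      exact ⟨(embOf_comp_algebraMap_eq_iff φ₀ k g).2 hg, hP⟩
  have hin : {g : G | g ∈ H ∧ g ∈ T}.ncard = {g : G | g ∈ H ∧ g ∉ T}.ncard := by
    have h := hbal (φ₀.comp (algebraMap k K))
    rw [hfib (fun φ => φ ∈ Φ.1), hfib (fun φ => φ ∉ Φ.1), Set.ncard_image_of_injective _ hinj,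
      Set.ncard_image_of_injective _ hinj] at h
    exact h
  -- the stabiliser lemma
  obtain ⟨u, hu1, hu⟩ := exists_ne_one_forall_mem_iff H hH hidx hnc complexConj_mul_self hcH
    complexConj_mul_comm hT hin
  -- `σ_1` and `σ_u` are not separated by the translates of `Φ`
  rw [isPrimitive_iff_forall_eq]
  intro hsep
  have hne : embOf φ₀ 1 ≠ embOf φ₀ u := fun h => hu1 (hinj h).symm
  refine hne (hsep _ _ fun τ => ?_)
  obtain ⟨δ, hδ⟩ := exists_algEquiv_comp_eq_smul φ₀ τ
  rw [smul_embOf_of_comp φ₀ hδ, smul_embOf_of_comp φ₀ hδ, one_mul]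
  exact hu δ⁻¹

/-! ## §2 A degenerate primitive type forces an imaginary quadratic subfield with ABELIAN `Gal(K/k)` -/

/-- **Structure theorem.**  For a GALOIS CM field of degree `12`, a PRIMITIVE DEGENERATE CM type forces an
imaginary quadratic subfield `k ⊆ K` (quadratic, with a complex place) whose group `Gal(K/k)` is COMMUTATIVE: by
`CMSixfoldRank.not_isNondegenerate_iff_exists_weilFibre` a degenerate primitive type is balanced `(3,3)` over some
imaginary quadratic `k`, and by §1 `Gal(K/k)` cannot then be non-commutative.
[cite: MoonenZarhin1999LowDim, Thm. 0.1 (1.4)] [cite: Dodson1984, §4 (p. 18) and §5.3] -/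
theorem exists_quadratic_comm_of_not_isNondegenerate [IsGalois ℚ K] (hK : Module.finrank ℚ K = 12)
    (φ₀ : K →+* ℂ) (hprim : IsPrimitive (ℂ ≃+* ℂ) Φ.1 φ₀) (hdeg : ¬ IsNondegenerate Φ) :
    ∃ k : IntermediateField ℚ K, Module.finrank ℚ k = 2 ∧
      (∃ τ₀ : k →+* ℂ, ComplexEmbedding.conjugate τ₀ ≠ τ₀) ∧
      ∀ a ∈ k.fixingSubgroup, ∀ b ∈ k.fixingSubgroup, a * b = b * a := by
  obtain ⟨k, hk2, τ₀, hτ₀, hbal⟩ :=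
    (CMSixfoldRank.not_isNondegenerate_iff_exists_weilFibre hK φ₀ hprim).1 hdeg
  refine ⟨k, hk2, ⟨τ₀, hτ₀⟩, ?_⟩
  by_contra! hnc
  exact not_isPrimitive_of_fibres_balanced_of_isGalois_twelve hK φ₀ k hk2 τ₀ hτ₀ hnc hbal hprim

/-- **The Galois group of the CM field of a degenerate simple CM sixfold (Galois case) is ABELIAN**: with `k` as in
`exists_quadratic_comm_of_not_isNondegenerate`, `Gal(K/k)` is commutative of index `2` and complex conjugation is a
central element outside it, so `Gal(K/ℚ) = Gal(K/k) ⊔ c·Gal(K/k)` is commutative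
(`GaloisDodecic.comm_of_index_two`). [cite: Dodson1984, §4 (p. 18) and §5.3] -/
theorem comm_of_isPrimitive_of_not_isNondegenerate [IsGalois ℚ K] (hK : Module.finrank ℚ K = 12)
    (φ₀ : K →+* ℂ) (hprim : IsPrimitive (ℂ ≃+* ℂ) Φ.1 φ₀) (hdeg : ¬ IsNondegenerate Φ)
    (x y : K ≃ₐ[ℚ] K) : x * y = y * x := by
  obtain ⟨k, hk2, ⟨τ₀, hτ₀⟩, hcomm⟩ := exists_quadratic_comm_of_not_isNondegenerate hK φ₀ hprim hdeg
  have hG : Nat.card (K ≃ₐ[ℚ] K) = 12 := by rw [IsGalois.card_aut_eq_finrank, hK]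
  have hKk : Module.finrank k K = 6 := by
    have h := Module.finrank_mul_finrank ℚ k K
    rw [hK, hk2] at h
    omega
  have hH : Nat.card k.fixingSubgroup = 6 := by rw [IsGalois.card_fixingSubgroup_eq_finrank k, hKk]
  have hidx : k.fixingSubgroup.index = 2 := by
    have h := k.fixingSubgroup.index_mul_card
    rw [hH, hG] at h
    omega
  exact comm_of_index_two k.fixingSubgroup hidx complexConj_mul_self
    (complexConj_not_mem_fixingSubgroup k τ₀ hτ₀) complexConj_mul_comm hcomm x y

/-- **… and NOT CYCLIC**: in a cyclic group of order `12` the involution `c` is a square, hence lies in the index-`2`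
subgroup `Gal(K/k)` (`GaloisDodecic.mem_of_isCyclic_of_four_dvd`) — but `c` moves the imaginary quadratic `k`.  So a
degenerate simple CM sixfold with Galois CM field has Galois group abelian and non-cyclic (`≅ ℤ/2 × ℤ/6`).
[cite: Dodson1984, §4 (p. 18) and §5.3] -/
theorem not_isCyclic_of_isPrimitive_of_not_isNondegenerate [IsGalois ℚ K] (hK : Module.finrank ℚ K = 12)
    (φ₀ : K →+* ℂ) (hprim : IsPrimitive (ℂ ≃+* ℂ) Φ.1 φ₀) (hdeg : ¬ IsNondegenerate Φ) :
    ¬ IsCyclic (K ≃ₐ[ℚ] K) := by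
  intro hcyc
  obtain ⟨k, hk2, ⟨τ₀, hτ₀⟩, -⟩ := exists_quadratic_comm_of_not_isNondegenerate hK φ₀ hprim hdeg
  have hG : Nat.card (K ≃ₐ[ℚ] K) = 12 := by rw [IsGalois.card_aut_eq_finrank, hK]
  have hKk : Module.finrank k K = 6 := by
    have h := Module.finrank_mul_finrank ℚ k K
    rw [hK, hk2] at h
    omega
  have hH : Nat.card k.fixingSubgroup = 6 := by rw [IsGalois.card_fixingSubgroup_eq_finrank k, hKk]
  have hidx : k.fixingSubgroup.index = 2 := by
    have h := k.fixingSubgroup.index_mul_card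
    rw [hH, hG] at h
    omega
  exact complexConj_not_mem_fixingSubgroup k τ₀ hτ₀
    (mem_of_isCyclic_of_four_dvd (by rw [hG]; norm_num) complexConj_mul_self k.fixingSubgroup hidx)

/-! ## §3 Nondegeneracy for non-abelian or cyclic Galois groups, and without imaginary quadratic subfields -/

/-- **Every PRIMITIVE CM type of a GALOIS CM field of degree `12` with NON-ABELIAN Galois group is
NONDEGENERATE** (Kubota rank `7 = dim A + 1`).  This covers the dihedral type `D₆ ≅ ℤ/2 × S₃` (the Galois closures
of the non-Galois "`D₆`-sextic" CM fields; Dodson's partition `64 = 4 + 12 + 12 + 12 + 24` with `24` primitive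
types) and the dicyclic type `Dic₃` at once, with no case analysis.  NEW. [cite: Dodson1984, §4 (p. 18) and §5.3]
[cite: MoonenZarhin1999LowDim, Thm. 0.1 (1.4)] -/
theorem isNondegenerate_of_isPrimitive_of_isGalois_twelve_of_not_comm [IsGalois ℚ K]
    (hK : Module.finrank ℚ K = 12) (hG : ∃ x y : K ≃ₐ[ℚ] K, x * y ≠ y * x)
    (φ₀ : K →+* ℂ) (hprim : IsPrimitive (ℂ ≃+* ℂ) Φ.1 φ₀) : IsNondegenerate Φ := by
  by_contra hdeg
  obtain ⟨x, y, hxy⟩ := hG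
  exact hxy (comm_of_isPrimitive_of_not_isNondegenerate hK φ₀ hprim hdeg x y)

/-- **Every PRIMITIVE CM type of a GALOIS CM field of degree `12` with CYCLIC Galois group is NONDEGENERATE**
(a second, classification-free proof of the degree-`12` case of the tree's cyclic theorem
`CorCM/CyclicCMTypesClassification`: here via "no imaginary quadratic subfield").
[cite: Dodson1984, §4 (p. 18) and §5.3] [cite: MoonenZarhin1999LowDim, Thm. 0.1 (1.4)] -/
theorem isNondegenerate_of_isPrimitive_of_isGalois_twelve_of_isCyclic [IsGalois ℚ K]
    (hK : Module.finrank ℚ K = 12) (hG : IsCyclic (K ≃ₐ[ℚ] K))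
    (φ₀ : K →+* ℂ) (hprim : IsPrimitive (ℂ ≃+* ℂ) Φ.1 φ₀) : IsNondegenerate Φ := by
  by_contra hdeg
  exact not_isCyclic_of_isPrimitive_of_not_isNondegenerate hK φ₀ hprim hdeg hG

/-- **Non-abelian or cyclic Galois group ⟹ nondegenerate** (the two cases together).
[cite: Dodson1984, §4 (p. 18) and §5.3] -/
theorem isNondegenerate_of_isPrimitive_of_isGalois_twelve [IsGalois ℚ K] (hK : Module.finrank ℚ K = 12)
    (hG : (∃ x y : K ≃ₐ[ℚ] K, x * y ≠ y * x) ∨ IsCyclic (K ≃ₐ[ℚ] K))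
    (φ₀ : K →+* ℂ) (hprim : IsPrimitive (ℂ ≃+* ℂ) Φ.1 φ₀) : IsNondegenerate Φ := by
  rcases hG with hG | hG
  · exact isNondegenerate_of_isPrimitive_of_isGalois_twelve_of_not_comm hK hG φ₀ hprim
  · exact isNondegenerate_of_isPrimitive_of_isGalois_twelve_of_isCyclic hK hG φ₀ hprim

/-- Rank form: a primitive CM type of a Galois CM field of degree `12` with non-abelian or cyclic Galois group has
Kubota rank `7` (`= n + 1`, `n = 6`). [cite: Dodson1987, Thm. 1.0 and §1.1] -/
theorem cmTypeRank_eq_seven_of_isPrimitive_of_isGalois_twelve [IsGalois ℚ K] (hK : Module.finrank ℚ K = 12)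
    (hG : (∃ x y : K ≃ₐ[ℚ] K, x * y ≠ y * x) ∨ IsCyclic (K ≃ₐ[ℚ] K))
    (φ₀ : K →+* ℂ) (hprim : IsPrimitive (ℂ ≃+* ℂ) Φ.1 φ₀) : cmTypeRank Φ = 7 :=
  (CMSixfoldRank.isNondegenerate_iff_cmTypeRank_eq_seven hK).1
    (isNondegenerate_of_isPrimitive_of_isGalois_twelve hK hG φ₀ hprim)

omit [IsCMField K] in
/-- **No imaginary quadratic subfield ⟹ nondegenerate** (no Galois hypothesis): if every quadratic subfield of the
CM field `K` of degree `12` is real (all its complex embeddings are self-conjugate), every primitive CM type of `K` is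
nondegenerate — immediate from `CMSixfoldRank.not_isNondegenerate_iff_exists_weilFibre`.  Examples: every Galois CM
field of degree `12` with cyclic or dicyclic group (their unique quadratic subfield is real), and the generic
`K = K⁺(√-α)` with `K⁺` a totally real sextic. [cite: MoonenZarhin1999LowDim, Thm. 0.1 (1.4)]
[cite: Gordon1999HodgeAVSurvey, 5.13 and 9.4] -/
theorem isNondegenerate_of_isPrimitive_of_forall_quadratic_isReal [IsCMField K] (hK : Module.finrank ℚ K = 12)
    (hreal : ∀ k : IntermediateField ℚ K, Module.finrank ℚ k = 2 → ∀ τ : k →+* ℂ, ComplexEmbedding.conjugate τ = τ)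
    (φ₀ : K →+* ℂ) (hprim : IsPrimitive (ℂ ≃+* ℂ) Φ.1 φ₀) : IsNondegenerate Φ := by
  by_contra hdeg
  obtain ⟨k, hk2, τ₀, hτ₀, -⟩ := (CMSixfoldRank.not_isNondegenerate_iff_exists_weilFibre hK φ₀ hprim).1 hdeg
  exact hτ₀ (hreal k hk2 τ₀)

/-- In a Galois CM field of degree divisible by `4` with CYCLIC Galois group every quadratic subfield is real
(complex conjugation, an involution of the cyclic group, is a square and so fixes every quadratic subfield:
`GaloisDodecic.mem_of_isCyclic_of_four_dvd`). [folklore] -/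
theorem conjugate_eq_of_isCyclic_of_four_dvd [IsGalois ℚ K] (h4 : 4 ∣ Module.finrank ℚ K)
    (hG : IsCyclic (K ≃ₐ[ℚ] K)) (k : IntermediateField ℚ K) (hk2 : Module.finrank ℚ k = 2) (τ : k →+* ℂ) :
    ComplexEmbedding.conjugate τ = τ := by
  by_contra hτ
  have hGcard : Nat.card (K ≃ₐ[ℚ] K) = Module.finrank ℚ K := IsGalois.card_aut_eq_finrank ℚ K
  obtain ⟨m, hm⟩ := h4
  have hKk : Module.finrank k K * 2 = Module.finrank ℚ K := by
    have h := Module.finrank_mul_finrank ℚ k K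
    rw [hk2] at h
    omega
  have hH : Nat.card k.fixingSubgroup = Module.finrank k K := IsGalois.card_fixingSubgroup_eq_finrank k
  have hidx : k.fixingSubgroup.index = 2 := by
    have h := k.fixingSubgroup.index_mul_card
    rw [hH, hGcard, ← hKk] at h
    have hpos : 0 < Module.finrank k K := Module.finrank_pos
    exact Nat.eq_of_mul_eq_mul_right hpos (by rw [h, mul_comm])
  exact complexConj_not_mem_fixingSubgroup k τ hτ
    (mem_of_isCyclic_of_four_dvd (by rw [hGcard]; exact ⟨m, hm⟩) complexConj_mul_self k.fixingSubgroup hidx)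

/-- **Primitive CM types of CM fields of degree `≤ 12` are nondegenerate, given Galois-ness in degree `8` and
Galois-ness with non-abelian or cyclic group in degree `12`**: degrees `≤ 10` by the tree's
`GaloisOctic.isNondegenerate_of_isPrimitive_of_finrank_le_ten` (Ribet's bound in degree `≤ 6`, the Galois octic
theorem, the prime theorem in degree `10`), degree `12` by `isNondegenerate_of_isPrimitive_of_isGalois_twelve`; a CM
field has even degree.  Both provisos are necessary: Mumford's degenerate CM fourfolds (non-Galois octic fields) and
the `ℤ/2 × ℤ/6` dodecic fields (`ℚ(ζ₂₁)`: tree `Pohlmann1968/DegenerateCMTypeCyclotomic21`).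
[cite: Dodson1984, §3.3.2 Theorem (p. 16), §4 (p. 18)] [cite: Ribet1980, Examples (3.7) (pp. 87–88)] -/
theorem isNondegenerate_of_isPrimitive_of_finrank_le_twelve (hK : Module.finrank ℚ K ≤ 12)
    (hGal8 : Module.finrank ℚ K = 8 → IsGalois ℚ K)
    (hGal12 : Module.finrank ℚ K = 12 →
      IsGalois ℚ K ∧ ((∃ x y : K ≃ₐ[ℚ] K, x * y ≠ y * x) ∨ IsCyclic (K ≃ₐ[ℚ] K)))
    (φ₀ : K →+* ℂ) (hprim : IsPrimitive (ℂ ≃+* ℂ) Φ.1 φ₀) : IsNondegenerate Φ := by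
  have heven : Module.finrank ℚ K = Module.finrank ℚ (maximalRealSubfield K) * 2 := by
    rw [← Algebra.IsQuadraticExtension.finrank_eq_two (maximalRealSubfield K) K, Module.finrank_mul_finrank]
  by_cases h10 : Module.finrank ℚ K ≤ 10
  · exact GaloisOctic.isNondegenerate_of_isPrimitive_of_finrank_le_ten h10 hGal8 φ₀ hprim
  · have h12 : Module.finrank ℚ K = 12 := by omega
    obtain ⟨hGal, hG⟩ := hGal12 h12
    haveI := hGal
    exact isNondegenerate_of_isPrimitive_of_isGalois_twelve h12 hG φ₀ hprim

end Main

/-! ## §4 Realisations: the Hodge conjecture for every power of a simple CM abelian sixfold with Galois CM field of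
non-abelian or cyclic Galois type -/

section Geometry

variable {K : Type} [Field K] [NumberField K] [IsCMField K] {Φ : CMType K}
variable {A : AbelianVariety ℂ} {ι : 𝓞 K →+* End A} {θ : K →+* Module.End ℂ (complexBetti A.X 1)}

/-- **A SIMPLE abelian sixfold with complex multiplication by a Galois CM field of non-abelian or cyclic Galois type
realises a nondegenerate type** (`A` simple ⟺ `Φ` primitive, Shimura §8.2 Prop. 26 — tree `isSimple_iff_isPrimitive`).
[cite: Dodson1984, §4 (p. 18) and §5.3] [cite: Shimura1998, §8.2 Prop. 26] -/
theorem isNondegenerate_of_isSimple_of_isGalois_twelve [IsGalois ℚ K] (hK : Module.finrank ℚ K = 12)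
    (hG : (∃ x y : K ≃ₐ[ℚ] K, x * y ≠ y * x) ∨ IsCyclic (K ≃ₐ[ℚ] K))
    (hA : IsCMTypeRealisation Φ A ι θ) (hs : A.IsSimple) : IsNondegenerate Φ := by
  obtain ⟨φ₀⟩ := (inferInstance : Nonempty (K →+* ℂ))
  exact isNondegenerate_of_isPrimitive_of_isGalois_twelve hK hG φ₀ ((isSimple_iff_isPrimitive hA φ₀).1 hs)

/-- **`Bᵐ(Aⁿ) ⊗ ℂ = Dᵐ(Aⁿ) ⊗ ℂ` on every power of a simple abelian sixfold with CM by a Galois CM field of non-abelian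
or cyclic Galois type** (`Hdg(Aⁿ) = Div(Aⁿ)` for all `n`, Hazama / Gordon Thm. 6.4).
[cite: Gordon1999HodgeAVSurvey, Thm. 6.4 and 9.4] -/
theorem hodgeClassSpan_pow_eq_divisorClassesSpan_of_isSimple_of_isGalois_twelve [IsGalois ℚ K]
    (hK : Module.finrank ℚ K = 12) (hG : (∃ x y : K ≃ₐ[ℚ] K, x * y ≠ y * x) ∨ IsCyclic (K ≃ₐ[ℚ] K))
    (hA : IsCMTypeRealisation Φ A ι θ) (hs : A.IsSimple) (n m : ℕ) :
    hodgeClassSpan (⨁ fun _ : Fin n => A).dim (⨁ fun _ : Fin n => A).X m =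
      divisorClassesSpan (⨁ fun _ : Fin n => A).X (⨁ fun _ : Fin n => A).dim m :=
  (isNondegenerate_of_isSimple_of_isGalois_twelve hK hG hA hs).hodgeClassSpan_pow_eq_divisorClassesSpan hA n m

/-- **No power of a simple abelian sixfold with CM by a Galois CM field of non-abelian or cyclic Galois type carries
an exceptional Hodge class**: every rational `(m,m)`-class on `Aⁿ` is a polynomial in divisor classes.
[cite: Gordon1999HodgeAVSurvey, Thm. 6.4 and 9.4] -/
theorem mem_divisorClassesSpan_pow_of_isSimple_of_isGalois_twelve [IsGalois ℚ K] (hK : Module.finrank ℚ K = 12)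
    (hG : (∃ x y : K ≃ₐ[ℚ] K, x * y ≠ y * x) ∨ IsCyclic (K ≃ₐ[ℚ] K))
    (hA : IsCMTypeRealisation Φ A ι θ) (hs : A.IsSimple) (n m : ℕ)
    {x : complexBetti (⨁ fun _ : Fin n => A).X (2 * m)} (hxQ : IsRationalClass x)
    (hxH : IsOfHodgeType (⨁ fun _ : Fin n => A).dim (⨁ fun _ : Fin n => A).X (2 * m) m m x) :
    x ∈ divisorClassesSpan (⨁ fun _ : Fin n => A).X (⨁ fun _ : Fin n => A).dim m :=
  (isNondegenerate_of_isSimple_of_isGalois_twelve hK hG hA hs).mem_divisorClassesSpan_pow hA n m hxQ hxH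

/-- **THE HODGE CONJECTURE FOR EVERY POWER `Aⁿ` OF EVERY SIMPLE ABELIAN SIXFOLD WITH COMPLEX MULTIPLICATION BY A
GALOIS CM FIELD WHOSE GALOIS GROUP IS NON-ABELIAN (dihedral `D₆`, dicyclic `Dic₃`) OR CYCLIC (`ℤ/12`) —
UNCONDITIONALLY** (no named fact: Lefschetz (1,1) and cup products via nondegeneracy, Hazama–Murty).
[cite: Dodson1984, §4 (p. 18) and §5.3] [cite: Gordon1999HodgeAVSurvey, Thm. 6.4 and 9.4] -/
theorem hodgeConjectureFor_pow_of_isSimple_of_isGalois_twelve [IsGalois ℚ K] (hK : Module.finrank ℚ K = 12)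
    (hG : (∃ x y : K ≃ₐ[ℚ] K, x * y ≠ y * x) ∨ IsCyclic (K ≃ₐ[ℚ] K))
    (hA : IsCMTypeRealisation Φ A ι θ) (hs : A.IsSimple) (n : ℕ) :
    HodgeConjectureFor (⨁ fun _ : Fin n => A).dim (⨁ fun _ : Fin n => A).X :=
  (isNondegenerate_of_isSimple_of_isGalois_twelve hK hG hA hs).hodgeConjectureFor_pow hA n

/-- **The Hodge conjecture for every simple abelian sixfold with complex multiplication by a Galois CM field of
non-abelian or cyclic Galois type** (the variety itself) — UNCONDITIONALLY. [cite: Dodson1984, §4 (p. 18) and §5.3]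
[cite: Gordon1999HodgeAVSurvey, Thm. 6.4 and 9.4] -/
theorem hodgeConjectureFor_of_isSimple_of_isGalois_twelve [IsGalois ℚ K] (hK : Module.finrank ℚ K = 12)
    (hG : (∃ x y : K ≃ₐ[ℚ] K, x * y ≠ y * x) ∨ IsCyclic (K ≃ₐ[ℚ] K))
    (hA : IsCMTypeRealisation Φ A ι θ) (hs : A.IsSimple) : HodgeConjectureFor A.dim A.X :=
  (isNondegenerate_of_isSimple_of_isGalois_twelve hK hG hA hs).hodgeConjectureFor hA

/-- **HC for all powers of every simple CM sixfold whose CM field of degree `12` has NO imaginary quadratic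
subfield** (no Galois hypothesis), unconditionally. [cite: MoonenZarhin1999LowDim, Thm. 0.1 (1.4)]
[cite: Gordon1999HodgeAVSurvey, Thm. 6.4 and 9.4] -/
theorem hodgeConjectureFor_pow_of_isSimple_of_forall_quadratic_isReal (hK : Module.finrank ℚ K = 12)
    (hreal : ∀ k : IntermediateField ℚ K, Module.finrank ℚ k = 2 → ∀ τ : k →+* ℂ, ComplexEmbedding.conjugate τ = τ)
    (hA : IsCMTypeRealisation Φ A ι θ) (hs : A.IsSimple) (n : ℕ) :
    HodgeConjectureFor (⨁ fun _ : Fin n => A).dim (⨁ fun _ : Fin n => A).X := by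
  obtain ⟨φ₀⟩ := (inferInstance : Nonempty (K →+* ℂ))
  exact (isNondegenerate_of_isPrimitive_of_forall_quadratic_isReal hK hreal φ₀
    ((isSimple_iff_isPrimitive hA φ₀).1 hs)).hodgeConjectureFor_pow hA n

/-- **The CM field of a DEGENERATE simple CM sixfold, if Galois, has abelian non-cyclic Galois group** — on the
variety: a simple realisation of a CM type of a Galois CM field of degree `12` carrying an exceptional Hodge class on
some power has `Gal(K/ℚ)` commutative and not cyclic. [cite: Dodson1984, §4 (p. 18) and §5.3]
[cite: Gordon1999HodgeAVSurvey, Thm. 6.4] -/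
theorem comm_and_not_isCyclic_of_isSimple_of_exceptional [IsGalois ℚ K] (hK : Module.finrank ℚ K = 12)
    (hA : IsCMTypeRealisation Φ A ι θ) (hs : A.IsSimple) (n m : ℕ)
    {x : complexBetti (⨁ fun _ : Fin n => A).X (2 * m)} (hxQ : IsRationalClass x)
    (hxH : IsOfHodgeType (⨁ fun _ : Fin n => A).dim (⨁ fun _ : Fin n => A).X (2 * m) m m x)
    (hx : x ∉ divisorClassesSpan (⨁ fun _ : Fin n => A).X (⨁ fun _ : Fin n => A).dim m) :
    (∀ g h : K ≃ₐ[ℚ] K, g * h = h * g) ∧ ¬ IsCyclic (K ≃ₐ[ℚ] K) := by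
  obtain ⟨φ₀⟩ := (inferInstance : Nonempty (K →+* ℂ))
  have hprim := (isSimple_iff_isPrimitive hA φ₀).1 hs
  have hdeg : ¬ IsNondegenerate Φ := fun hnd => hx (hnd.mem_divisorClassesSpan_pow hA n m hxQ hxH)
  exact ⟨comm_of_isPrimitive_of_not_isNondegenerate hK φ₀ hprim hdeg,
    not_isCyclic_of_isPrimitive_of_not_isNondegenerate hK φ₀ hprim hdeg⟩

end Geometry

end Summit.HodgeConjecture.CorCM.GaloisDodecic

end
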